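import Mathlib.Geometry.Manifold.Instances.Sphere
import Mathlib.Geometry.Manifold.Diffeomorph
import Literature.Topology.FourManifolds.GluckTwist
import Literature.Topology.FourManifolds.GluckTwistHomotopySphere
import Literature.Topology.FourManifolds.ConnectedSum
import Literature.Topology.FourManifolds.ComplexProjectiveSpace
import Literature.Topology.FourManifolds.HomotopyBallSlice
import Literature.Topology.FourManifolds.LeeRasmussen
import Literature.Topology.FourManifolds.Rasmussen
import Literature.Topology.FourManifolds.SphereSimplyConnected
import HarnessLib
import HarnessLib.Audit

/-!
# Barrier (SmoothPoincare4): Gluck twists dissolve in `ℂℙ²` — `ℂℙ²`-cancellative invariants and the `s`-invariant slicing strategy cannot detect them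

Barrier catalogue `Literature/Barriers/SmoothPoincare4/` (D-0021), entry for the technique
class **"detect an exotic Gluck twist `Σ_K` (hence refute `SmoothPoincare4` /
`Literature.Topology.FourManifolds.GluckTwistConjecture`) by an invariant that survives one connected sum with `ℂℙ²`"**,
and its printed knot-level instance, the Freedman–Gompf–Morrison–Walker strategy with
Rasmussen's `s`.

## What is printed

* Dissolution. For every compact smooth 4-manifold `M` and smoothly embedded 2-sphere `S ⊂ M`
  with trivial normal bundle, `M_S # ℂℙ² ≅ M # ℂℙ²` (diffeomorphic), `M_S` the Gluck twist:
  Kasprowski–Powell–Ray 2023, Lemma 3.1 ("In the smooth category, the diffeomorphism of the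
  ambient manifolds `M_S # ℂℙ² ≅ M # ℂℙ²` in the statement is well-known (see e.g. [GS99,
  Exercise 5.2.7 (b)])"); Akbulut–Yasui 2013, Cor. 1.3 ("If `X − ν(S)` has a simply connected
  codimension 0 submanifold with odd intersection form, then Gluck twisting `X` along `S` does not
  change the diffeomorphism type of `X`", cf. [GS99]). For `M = S⁴`: a homotopy 4-sphere `X`
  obtained by a Gluck twist satisfies "`X # ℂℙ² ≅ ℂℙ²` and `X # ℂℙ²bar ≅ ℂℙ²bar`; cf. [GS]"
  (Manolescu–Marengon–Sarkar–Willis 2023, proof of Cor. 6.15 = Cor. 1.13); "homotopy 4-spheres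
  coming from Gluck twists dissolve after a single connected sum with `ℂℙ²bar`" (Ren–Willis 2024,
  §6.10, titled "`ℂℙ²bar`-stably standard homotopy spheres"). For a homotopy sphere `Σ`,
  `Σ # ℂℙ²bar ≅ ℂℙ²bar` iff `(−Σ) # ℂℙ² ≅ ℂℙ²` (reverse all orientations), and `−Σ_K` is again a
  Gluck twist (of the reflected 2-knot), so the two oriented statements are two readings of one
  unoriented fact.
* MMSW 2023, Cor. 1.13: "Let `X` be a homotopy 4-sphere obtained by a Gluck twist on a 2-knot in
  `S⁴`. If a link `L ⊂ S³` is strongly slice in `X`, then `s(L) = 1 − |L|`." — "It follows ...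
  that this strategy [FGMW: find a homotopy 4-sphere `X` and a knot `K ⊂ S³` that is slice in `X`
  (i.e., bounds a smoothly embedded disk in `X ∖ B⁴`), and prove that it is not slice in `S⁴` by
  showing that `s(K) ≠ 0`] cannot work for a large class of potential counterexamples to the
  smooth 4D Poincaré conjecture, namely those obtained by Gluck twists" (p. 5); §9.3: "It remains
  an open question whether the strategy can work for other homotopy 4-spheres" (Question 9.11).
* Ren–Willis 2024, Prop. 6.17: "If `Σ` is a homotopy 4-sphere with `Σ # kℂℙ²bar = kℂℙ²bar` for
  some `k`, then `S₀²(Σ; ℚ) = ℚ`, concentrated in tri-degree `(0, 0, 0)`" (the Khovanov–Rozansky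
  `gl₂` skein lasagna module over `ℚ` "is unable to detect potential exotic 4-spheres that dissolve
  after taking connected sums with copies of `ℂℙ²bar`", §6.10; note that `ℂℙ²` itself — a sphere
  of positive self-intersection — has VANISHING module, Example 3.2, while `kℂℙ²bar` does not,
  Remark 3.4, so the bar matters). Neither this nor MMSW Cor. 1.13 is printed as membership of an
  invariant in the class `IsCP2Cancellative` below; they are independent blindness theorems that
  share the dissolution input.

## How it is rendered here (relative to the tree's named facts, D-0014)

* `gluckTwist_connectedSum_complexProjectivePlane` — named fact: every connected sum (the tree's
  orientation-free `Literature.Topology.FourManifolds.IsConnectedSum`) of a Gluck twist `X` of `S⁴` with `ℂℙ²`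
  (`Literature.Topology.FourManifolds.ComplexProjectivePlane`) is diffeomorphic to `ℂℙ²`; this is the conjunction of the two
  printed oriented statements `X # ℂℙ² ≅ ℂℙ²`, `X # ℂℙ²bar ≅ ℂℙ²bar`.
* `IsCP2Cancellative I` — the technique class, an explicit definition: `α`-valued functions `I`
  of connected closed smooth 4-manifolds which cannot separate `M` from `N` once a connected sum
  of `M` with `ℂℙ²` is diffeomorphic to a connected sum of `N` with `ℂℙ²`. It contains every
  invariant of the (one-step) `ℂℙ²`-stable diffeomorphism type of connected closed 4-manifolds.
* `GluckTwistCP2Barrier.{u}` — the barrier (universe-polymorphic in the value type): every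
  `ℂℙ²`-cancellative `I` takes the same value on every Gluck twist as on `S⁴`; PROVED
  (`gluckTwistCP2Barrier_of_dissolve`) from the dissolution fact, two tree facts on connected sums
  (`Literature.Topology.FourManifolds.isConnectedSum_sphere_self`, `Literature.Topology.FourManifolds.exists_isConnectedSum`), the tree fact that a Gluck
  twist is `≃ₕ S⁴` (`Literature.Topology.FourManifolds.nonempty_homotopyEquiv_sphere_of_isGluckTwist`) and the tree's proof of
  `π₁(S⁴) = 1` (connectedness).
* `rasmussen_eq_zero_of_isSliceDiscIn_gluckTwist` — named fact, MMSW 2023 Cor. 1.13 for knots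
  (`|L| = 1`), through the tree's `Literature.Topology.FourManifolds.Knot.IsSliceDiscIn` and `Literature.Topology.FourManifolds.Knot.HasRasmussenInvariant`.
* `FGMWRasmussenStrategy` — the strategy's success condition ("some knot slice in a homotopy
  4-ball has `s ≠ 0`") as a Prop. It is a registered OPEN STATEMENT (docstring
  `OPEN CONJECTURE — … [status: open]`), not a named fact awaiting discharge: its negation is
  exactly MMSW's open Question 9.11 for knots (`MMSW2023Question911Knot`, likewise registered open;
  `not_fgmwRasmussenStrategy_iff_question`). PROVED: a success yields an exotic 4-sphere
  (`FGMWRasmussenStrategy.exists_exotic`, from tree facts).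
* `not_fgmwRasmussenStrategyGluck` — the knot-level barrier, statement spelled out: GIVEN Cor. 1.13
  for knots, no knot slice in a punctured closed smooth Gluck twist of `S⁴` has `s ≠ 0`.

## Verdict clean-up (2026-08-15)

The closed Prop `FGMWRasmussenStrategyGluck` ("some knot is slice in a punctured closed smooth
Gluck twist of `S⁴` and has `s ≠ 0`", the FGMW `s`-strategy restricted to Gluck twists), formerly
declared here with a citation tag as if it were a fact, was DELETED (after one revision as a
`@[deprecated]` alias while its importer was rewired): it is refuted by MMSW 2023, Cor. 1.13 — its
negation is the theorem `not_fgmwRasmussenStrategyGluck` (kept, statement spelled out, GIVEN the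
named fact `rasmussen_eq_zero_of_isSliceDiscIn_gluckTwist`), and the sibling
`GluckTwistsDissolveProofs.lean` had shown it literally equivalent to the negation of that fact, so
no `_holds` theorem could ever exist. With it went the bridging lemma
`FGMWRasmussenStrategyGluck.fgmwRasmussenStrategy` (Gluck case ⇒ general case; now the one-liner
`Knot.IsSliceDiscIn.isHomotopyBallSlice` with `nonempty_homotopyEquiv_sphere_of_isGluckTwist`).
`FGMWRasmussenStrategy` and `MMSW2023Question911Knot` are registered OPEN statements
(`@[conjecture]`; posed: Freedman–Gompf–Morrison–Walker 2010, §1; MMSW 2023, p. 5 and Question 9.11),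
each the negation of the other (`not_fgmwRasmussenStrategy_iff_question`); their names are kept
(in-file API `FGMWRasmussenStrategy.exists_exotic`, user `GluckTwistsDissolveProofs.lean`).

## Sharpening (2026-08-16): beyond Gluck twists — every homotopy 4-sphere dissolving in `ℂℙ²` and `ℂℙ²bar` is `s`-blind

MMSW's own remark after Question 9.11 (§9.3, p. 30 of arXiv:1910.08195v4): "When `X` was obtained by a
Gluck twist from `S⁴`, the key facts we used to answer this question in the affirmative were that
`X # ℂℙ² ≅ ℂℙ²` and `X # ℂℙ²bar ≅ ℂℙ²bar`. The same result would hold for any homotopy 4-sphere `X`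
satisfying `X # (#ʳℂℙ²) = #ʳℂℙ²` and `X # (#ʳℂℙ²bar) = #ʳℂℙ²bar` for some `r`." (proof: that of
Cor. 6.15 via Cor. 6.13, p. 19). The case `r = 1`, `|L| = 1` is vendored below as the named fact
`mmsw2023_sZero_of_dissolvesInCP2`, over the predicate `DissolvesInCP2 X` ("every closed smooth connected
sum of `X` with `ℂℙ²` is diffeomorphic to `ℂℙ²`" — orientation-free, hence both oriented dissolutions at
once, exactly as in `gluckTwist_connectedSum_complexProjectivePlane`, which says that Gluck twists
`DissolvesInCP2`: `dissolvesInCP2_of_isGluckTwist`). Consequences recorded as theorems: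
* `sZero_of_isSliceDiscIn_gluckTwist_of_mmsw2023` — the new fact contains the knot case of Cor. 1.13 for
  closed Gluck twists given with their homotopy equivalence to `S⁴`;
* `mmsw2023Question911Knot_of_cp2Rigid` / `not_fgmwRasmussenStrategy_of_cp2Rigid` — Question 9.11 (knots)
  follows from the OPEN statement "`ℂℙ²` is rigid on homotopy-sphere sums" (every closed smooth `Σ # ℂℙ²`
  with `Σ ≃ₕ S⁴` closed smooth is `≅ ℂℙ²`; a consequence of SPC4 and of uniqueness of the smooth structure
  on `ℂℙ²`; spelled out as a hypothesis, not declared here), so the FGMW `s`-strategy is blocked by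
  `ℂℙ²`-rigidity, a statement weaker than SPC4 on paper;
* `exoticCP2Sum_of_fgmwRasmussenStrategy` — THE PRICE OF AN `s`-WITNESS: a knot slice in a homotopy ball
  with `s ≠ 0` yields a closed smooth homotopy 4-sphere `X` and a closed smooth connected sum `P` of `X`
  with `ℂℙ²` admitting no diffeomorphism to `ℂℙ²` — by Freedman an exotic `ℂℙ²` (up to orientation; with
  the sign of `s` fixed, `X # r ℂℙ²bar` resp. `X # r ℂℙ²` is exotic for every `r ≥ 1`). No exotic `ℂℙ²`,
  indeed no exotic closed definite simply connected 4-manifold, is known ("All known exotic examples of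
  simply-connected four-manifolds have the property that this form is indefinite", Manolescu's survey
  arXiv:2601.05425 (2026), before Question 3.2 "Does there exist an exotic smooth structure on `#n ℂℙ²`
  for some `n ≥ 0`?", presented there, p. 25, as a goal LESS ambitious than SPC4 — the theorem says the
  `s`-strategy for SPC4 is at least as hard as its case `n = 1`); MMSW Question 9.12 asks the `r`-fold
  dissolution already for balanced-presentation spheres.
Users: the zero-surgery crux work (`Summits/SmoothPoincare4/SmoothPoincare4/Cruxes/ZseCruxRasmussen/Disproof.lean`
§7, whose local copies of these declarations this section supersedes).

## References

[KasprowskiPowellRay2023] [AkbulutYasui2013] [GompfStipsicz1999] [ManolescuMarengonSarkarWillis2023]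
[RenWillis2024] [FreedmanGompfMorrisonWalker2010] [KronheimerMrowka2013]
[KronheimerMrowka2019Corrigendum] [Gong2020KMConcordance] [GluckTAMS1962] [Rasmussen2010]
[NaylorSchwartz2022] [Sunukjian2015]
-/

noncomputable section

open scoped Manifold ContDiff
open ContinuousMap

namespace Literature.Barriers.SmoothPoincare4

universe u

/-- Local notation: `𝔼 n` is the model Euclidean space `EuclideanSpace ℝ (Fin n)`. -/
local notation "𝔼 " n:arg => EuclideanSpace ℝ (Fin n)

/-- Local notation: `𝕊 n` is the unit sphere in `EuclideanSpace ℝ (Fin (n + 1))`, the standard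
`n`-sphere with its Mathlib manifold structure. -/
local notation "𝕊 " n:arg => (Metric.sphere (0 : EuclideanSpace ℝ (Fin (n + 1))) 1)

/-! ### The dissolution fact -/

/-- **Gluck twists dissolve after one `ℂℙ²` summand** (named fact). For every 2-knot `K` and every
(Hausdorff, second countable) smooth 4-manifold `X` which is a Gluck twist of `S⁴` along `K`
(`Literature.IsGluckTwist (𝓡 4) X K`), every smooth 4-manifold `P` which is a connected sum of `X` and
`ℂℙ²` (`Literature.Topology.FourManifolds.IsConnectedSum`, `Literature.Topology.FourManifolds.ComplexProjectivePlane`) is diffeomorphic to `ℂℙ²`. Printed: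
`M_S # ℂℙ² ≅ M # ℂℙ²` for any compact smooth `M` and 2-sphere `S ⊂ M` with trivial normal bundle
(Kasprowski–Powell–Ray 2023, Lemma 3.1, smooth case credited to Gompf–Stipsicz 1999,
Ex. 5.2.7 (b); also Akbulut–Yasui 2013, Cor. 1.3 applied to `ℂℙ² ∖ ν(K) ⊃ ℂℙ² ∖ B⁴`), with
`M = S⁴`, `S⁴ # ℂℙ² ≅ ℂℙ²`; for Gluck twists of `S⁴` both "`X # ℂℙ² ≅ ℂℙ²` and
`X # ℂℙ²bar ≅ ℂℙ²bar`" are recorded in Manolescu–Marengon–Sarkar–Willis 2023 (proof of Cor. 6.15),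
the latter also in Ren–Willis 2024, §6.10 ("dissolve after a single connected sum with `ℂℙ²bar`").
The tree's `IsConnectedSum` carries no orientation, so `P` ranges over both `X # ℂℙ²` and
`X # ℂℙ²bar` (as unoriented manifolds); the statement is therefore exactly the conjunction of the
two printed ones (`ℂℙ²bar ≅ ℂℙ²` unoriented; equivalently, for a homotopy sphere,
`X # ℂℙ²bar ≅ ℂℙ²bar` iff `(−X) # ℂℙ² ≅ ℂℙ²`, and the class of Gluck twists is closed under
orientation reversal — `τ` is conjugation invariant under the reflections, Gluck 1962 §8, as
recorded in the tree's `GluckTwist.lean`). [cite: GluckTAMS1962, §8]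
[cite: KasprowskiPowellRay2023, Lemma 3.1] [cite: AkbulutYasui2013, Cor. 1.3]
[cite: ManolescuMarengonSarkarWillis2023, proof of Cor. 6.15] [cite: RenWillis2024, §6.10] -/
def gluckTwist_connectedSum_complexProjectivePlane : Prop :=
  ∀ (K : Literature.Topology.FourManifolds.TwoKnot) (X : Type) [TopologicalSpace X] [T2Space X] [SecondCountableTopology X]
    [ChartedSpace (𝔼 4) X] [IsManifold (𝓡 4) ∞ X] (_hX : Literature.Topology.FourManifolds.IsGluckTwist (𝓡 4) X K)
    (P : Type) [TopologicalSpace P] [T2Space P] [SecondCountableTopology P]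
    [ChartedSpace (𝔼 4) P] [IsManifold (𝓡 4) ∞ P]
    (_hP : Literature.Topology.FourManifolds.IsConnectedSum (𝓡 4) (𝓡 4) (𝓡 4) X Literature.Topology.FourManifolds.ComplexProjectivePlane P),
    Nonempty (P ≃ₘ⟮𝓡 4, 𝓡 4⟯ Literature.Topology.FourManifolds.ComplexProjectivePlane)

/-! ### The technique class -/

/-- **Technique class: `ℂℙ²`-cancellative functions of connected closed smooth 4-manifolds.** A
function `I` assigning a value in `α` to every 4-dimensional charted space (only its values on
connected closed smooth 4-manifolds — Hausdorff, second countable, compact, connected, `C^∞` on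
`ℝ⁴`, in `Type` — matter) is `ℂℙ²`-cancellative if `I M = I N` whenever `M`, `N` are connected
closed smooth and some connected sum `P` of `M` with `ℂℙ²` is diffeomorphic to some connected sum
`P'` of `N` with `ℂℙ²` (`P`, `P'` closed smooth). Every invariant of the one-step `ℂℙ²`-stable
diffeomorphism type of connected manifolds (i.e. `I P = I M` whenever `P` is a connected sum
`M # ℂℙ²`, `M` connected) is in the class (`isCP2Cancellative_of_stable`), as is every
diffeomorphism invariant admitting cancellation of a `ℂℙ²` summand. Connectedness of `M`, `N` is
imposed because the tree's `Literature.Topology.FourManifolds.IsConnectedSum` records no connectedness (for disconnected `M` the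
`ℂℙ²` summand may land in any component, a relation under which componentwise-multiplicative
invariants are not stable); since `IsConnectedSum` is also orientation-free, `I` is a function of
unoriented manifolds and "connected sum with `ℂℙ²`" covers both `# ℂℙ²` and `# ℂℙ²bar`.
This is the class over which the printed remarks quantify: "The same result would hold for any
homotopy 4-sphere `X` satisfying `X # (#ʳ ℂℙ²) = #ʳ ℂℙ²` and `X # (#ʳ ℂℙ²bar) = #ʳ ℂℙ²bar`"
(MMSW 2023, §9.3, here `r = 1`); "the Khovanov skein lasagna module, at least over `ℚ`, is unable
to detect potential exotic 4-spheres that dissolve after taking connected sums with copies of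
`ℂℙ²bar`" (Ren–Willis 2024, §6.10). Membership of these two invariants in the class is NOT
printed (MMSW use the dissolution one-directionally, Ren–Willis cancel a tensor factor only against
the unit); they are cited as the printed occasions of the quantification, not as members.
[cite: ManolescuMarengonSarkarWillis2023, §9.3] [cite: RenWillis2024, §6.10] -/
def IsCP2Cancellative {α : Type*} (I : ∀ (M : Type) [TopologicalSpace M] [ChartedSpace (𝔼 4) M], α) :
    Prop :=
  ∀ (M N P P' : Type)
    [TopologicalSpace M] [T2Space M] [SecondCountableTopology M] [ChartedSpace (𝔼 4) M]
    [IsManifold (𝓡 4) ∞ M] [CompactSpace M] [ConnectedSpace M]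
    [TopologicalSpace N] [T2Space N] [SecondCountableTopology N] [ChartedSpace (𝔼 4) N]
    [IsManifold (𝓡 4) ∞ N] [CompactSpace N] [ConnectedSpace N]
    [TopologicalSpace P] [T2Space P] [SecondCountableTopology P] [ChartedSpace (𝔼 4) P]
    [IsManifold (𝓡 4) ∞ P] [CompactSpace P]
    [TopologicalSpace P'] [T2Space P'] [SecondCountableTopology P'] [ChartedSpace (𝔼 4) P']
    [IsManifold (𝓡 4) ∞ P'] [CompactSpace P'],
    Literature.Topology.FourManifolds.IsConnectedSum (𝓡 4) (𝓡 4) (𝓡 4) M Literature.Topology.FourManifolds.ComplexProjectivePlane P →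
    Literature.Topology.FourManifolds.IsConnectedSum (𝓡 4) (𝓡 4) (𝓡 4) N Literature.Topology.FourManifolds.ComplexProjectivePlane P' →
    Nonempty (P ≃ₘ⟮𝓡 4, 𝓡 4⟯ P') → I M = I N

/-- A function of the one-step `ℂℙ²`-stable diffeomorphism type of connected manifolds — `I P = I M`
whenever the closed smooth `P` is a connected sum of the connected closed smooth `M` with `ℂℙ²` —
which is moreover a diffeomorphism invariant of closed smooth 4-manifolds is `ℂℙ²`-cancellative (so
the class contains all "`ℂℙ²`-stable invariants" of connected closed 4-manifolds).
[cite: RenWillis2024, §6.10] -/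
theorem isCP2Cancellative_of_stable {α : Type*}
    {I : ∀ (M : Type) [TopologicalSpace M] [ChartedSpace (𝔼 4) M], α}
    (hdiff : ∀ (P P' : Type)
      [TopologicalSpace P] [T2Space P] [SecondCountableTopology P] [ChartedSpace (𝔼 4) P]
      [IsManifold (𝓡 4) ∞ P] [CompactSpace P]
      [TopologicalSpace P'] [T2Space P'] [SecondCountableTopology P'] [ChartedSpace (𝔼 4) P']
      [IsManifold (𝓡 4) ∞ P'] [CompactSpace P'],
      Nonempty (P ≃ₘ⟮𝓡 4, 𝓡 4⟯ P') → I P = I P')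
    (hstab : ∀ (M P : Type)
      [TopologicalSpace M] [T2Space M] [SecondCountableTopology M] [ChartedSpace (𝔼 4) M]
      [IsManifold (𝓡 4) ∞ M] [CompactSpace M] [ConnectedSpace M]
      [TopologicalSpace P] [T2Space P] [SecondCountableTopology P] [ChartedSpace (𝔼 4) P]
      [IsManifold (𝓡 4) ∞ P] [CompactSpace P],
      Literature.Topology.FourManifolds.IsConnectedSum (𝓡 4) (𝓡 4) (𝓡 4) M Literature.Topology.FourManifolds.ComplexProjectivePlane P → I P = I M) :
    IsCP2Cancellative I := by
  intro M N P P' _ _ _ _ _ _ _ _ _ _ _ _ _ _ _ _ _ _ _ _ _ _ _ _ _ _ hP hP' e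
  rw [← hstab M P hP, ← hstab N P' hP', hdiff P P' e]

/-! ### The barrier -/

/-- **Barrier (named statement): no `ℂℙ²`-cancellative invariant distinguishes a Gluck twist from
`S⁴`.** For every type of values `α : Type u` (the universe is a parameter,
`GluckTwistCP2Barrier.{u}`, so that module- or category-valued invariants are covered), every
`ℂℙ²`-cancellative `I` (`IsCP2Cancellative I`), every 2-knot `K` and every closed smooth 4-manifold
`X` which is a Gluck twist of `S⁴` along `K`, `I X = I S⁴`. PROVED below
(`gluckTwistCP2Barrier_of_dissolve`) from the dissolution fact
`gluckTwist_connectedSum_complexProjectivePlane`, the tree's connected-sum facts, and (for the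
connectedness of `X` and `S⁴` the class requires) the tree fact that a Gluck twist is a homotopy
4-sphere and the tree's proof that `S⁴` is simply connected; so relative to Literature the barrier
is a theorem.

BARRIER (D-0021), one line per key:
* technique_class: `ℂℙ²`-cancellative functions of connected closed smooth (unoriented) 4-manifolds (`IsCP2Cancellative`: `I M = I N` as soon as a connected sum of `M` with `ℂℙ²` is diffeomorphic to one of `N` with `ℂℙ²`), in particular all invariants of the one-step `ℂℙ²`-stable diffeomorphism type of connected closed 4-manifolds (`isCP2Cancellative_of_stable`) — the class of homotopy spheres over which MMSW's remark quantifies ("any homotopy 4-sphere `X` satisfying `X # (#ʳ ℂℙ²) = #ʳ ℂℙ²` and `X # (#ʳ ℂℙ²bar) = #ʳ ℂℙ²bar`") [cite: ManolescuMarengonSarkarWillis2023, §9.3]; membership of Rasmussen's `s` or of the skein lasagna module in this class is NOT printed (see because:/scope_caveats:).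
* blocks: refuting `Literature.Topology.FourManifolds.GluckTwistConjecture` (route conjunct `GlasGluckTwistConjecture`, whose negation is the thesis `GlasThesis`, of Summits/SmoothPoincare4/SmoothPoincare4/Theses/GluckLasagna.lean; hence `¬ SmoothPoincare4` via a Gluck twist) by exhibiting such an `I` with `I Σ_K ≠ I S⁴` (`GluckTwistCP2Barrier`); and the knot-level Freedman–Gompf–Morrison–Walker strategy "find `K ⊂ S³` slice in `X ∖ B⁴` with `s(K) ≠ 0`" [cite: FreedmanGompfMorrisonWalker2010, §1 pp. 3-4] for `X` a Gluck twist (`not_fgmwRasmussenStrategyGluck`) [cite: ManolescuMarengonSarkarWillis2023, Cor. 1.13].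
* because: `Σ_K # ℂℙ² ≅ ℂℙ² = S⁴ # ℂℙ²` and `Σ_K # ℂℙ²bar ≅ ℂℙ²bar` for every 2-knot `K` [cite: KasprowskiPowellRay2023, Lemma 3.1] [cite: AkbulutYasui2013, Cor. 1.3] [cite: ManolescuMarengonSarkarWillis2023, proof of Cor. 6.15], so a `ℂℙ²`-cancellative `I` has `I Σ_K = I S⁴` (`gluckTwistCP2Barrier_of_dissolve`); for `s`: a link strongly slice in `X ∖ B⁴` is strongly H-slice in `ℂℙ² ∖ B⁴` and in `ℂℙ²bar ∖ B⁴`, where the adjunction inequality for `s` gives `s(L) ≤ 1 - |L|` and `s(L̄) ≤ 1 - |L|`, whence equality [cite: ManolescuMarengonSarkarWillis2023, Cor. 6.13 and proof of Cor. 6.15]; for the lasagna module (an independent printed blindness theorem, not a membership statement): `S₀²(Σ; ℚ) ⊗ S₀²(ℂℙ²bar; ℚ)^{⊗k} ≅ S₀²(ℂℙ²bar; ℚ)^{⊗k}` by the connected-sum formula, and nonvanishing plus a local finiteness property of `S₀²(ℂℙ²bar; ℚ)` force `S₀²(Σ; ℚ) = ℚ` for every homotopy sphere with `Σ # kℂℙ²bar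 ≅ kℂℙ²bar` [cite: RenWillis2024, Prop. 6.17 with Props. 2.4, 6.16 and Remark 3.4] (with `ℂℙ²` in place of `ℂℙ²bar` the argument is void: `S₀²(ℂℙ²) = 0` [cite: RenWillis2024, Example 3.2]).
* evasions_known: none published for Gluck twists — MMSW ask whether the `s`-strategy can work for homotopy 4-spheres NOT arising from Gluck twists [cite: ManolescuMarengonSarkarWillis2023, §9.3, Questions 9.11 and 9.12] (`MMSW2023Question911Knot`, open); Ren–Willis's blindness is proved over `ℚ` only ("at least over `ℚ`") and for `ℂℙ²bar`-stabilisation [cite: RenWillis2024, §6.10 and Prop. 6.17]; positive results remove sub-families from contention instead (the Gluck twist is `S⁴` for ribbon 2-knots, twist-spun knots, band sums of links with ribbon or twist-spun components, and 2-knots `0`-concordant to the unknot [cite: Sunukjian2015, §2.1], and for `m`-twist `n`-roll spins of unknotting number one knots [cite: NaylorSchwartz2022, Thm. 2.4]).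
* scope_caveats: (a) only ONE-step dissolution is printed for Gluck twists (`r = 1`); for other homotopy 4-spheres (e.g. `D(P)` from balanced presentations) even `X # rℂℙ² ≅ rℂℙ²` for some `r` is open [cite: ManolescuMarengonSarkarWillis2023, Question 9.12], so the barrier says nothing about them; (b) the class is stated for functions of UNORIENTED, CONNECTED closed smooth 4-manifolds in `Type` (the tree's `IsConnectedSum` records neither orientation nor connectedness; connectedness of `M`, `N` is imposed explicitly), so an orientation-sensitive invariant enters only through its values on both orientations — harmless for the conclusion `I Σ_K = I S⁴`; (c) MMSW Cor. 1.13 is vendored for knots only (`|L| = 1`; the tree has no link `s`-invariant) and with the tree's orientation-free `IsSliceDiscIn` (ball embeddings of either orientation), which the printed proof covers since it treats `L` and `L̄` symmetrically via `ℂℙ²` and `ℂℙ²bar`; neither `s` (used one-directionally: slice in `X` ⇒ H-slice in `ℂℙ² ∖ B⁴` and `ℂℙ²bar ∖ B⁴`) nor the lasagna module (cancellation only against the unit, over `ℚ`, with `ℂℙ²bar`) is printed to lie in `IsCP2Cancellative`, so `GluckTwistCP2Barrier` and these two theorems are three separate printed consequences of the one dissolution fact; (d) Kronheimer–Mrowka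 2013, Cor. 1.1 had asserted `s(K) = 0` for every knot slice in ANY homotopy 4-ball [cite: KronheimerMrowka2013, Cor. 1.1], which would block the strategy outright, but the identification `s = s♯` used there was withdrawn [cite: KronheimerMrowka2019Corrigendum, abstract] (`s♯` is not a concordance homomorphism [cite: Gong2020KMConcordance, §1]); the general statement is MMSW's open Question 9.11, vendored here as a Prop, not as a fact.
* status: established (theorem `gluckTwistCP2Barrier_of_dissolve` relative to the named fact `gluckTwist_connectedSum_complexProjectivePlane`; named fact `rasmussen_eq_zero_of_isSliceDiscIn_gluckTwist`) [cite: KasprowskiPowellRay2023, Lemma 3.1] [cite: ManolescuMarengonSarkarWillis2023, Cor. 1.13]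

[cite: ManolescuMarengonSarkarWillis2023, Cor. 1.13 and §9.3] [cite: RenWillis2024, Prop. 6.17] -/
def GluckTwistCP2Barrier : Prop :=
  ∀ (α : Type u) (I : ∀ (M : Type) [TopologicalSpace M] [ChartedSpace (𝔼 4) M], α),
    IsCP2Cancellative I →
    ∀ (K : Literature.Topology.FourManifolds.TwoKnot) (X : Type) [TopologicalSpace X] [T2Space X] [SecondCountableTopology X]
      [ChartedSpace (𝔼 4) X] [IsManifold (𝓡 4) ∞ X] [CompactSpace X],
      Literature.Topology.FourManifolds.IsGluckTwist (𝓡 4) X K → I X = I (𝕊 4)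

/-- **The mechanism, for one invariant.** A `ℂℙ²`-cancellative `I` takes on every closed Gluck
twist `X` of `S⁴` the value `I S⁴`, GIVEN the dissolution fact
(`gluckTwist_connectedSum_complexProjectivePlane`), `ℂℙ² = ℂℙ² # S⁴` in the tree's relational form
(`Literature.Topology.FourManifolds.isConnectedSum_sphere_self`, Kervaire–Milnor 1963 §2) and the existence of a closed smooth
connected sum `X # ℂℙ²` (`Literature.Topology.FourManifolds.exists_isConnectedSum`): `I X = I S⁴` because `X # ℂℙ² ≅ ℂℙ²` and
`ℂℙ²` is a connected sum of `S⁴` and `ℂℙ²`. Connectedness of `X` and `S⁴`, required by the class,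
comes from simple connectivity: `X ≃ₕ S⁴` (tree fact `Literature.Topology.FourManifolds.nonempty_homotopyEquiv_sphere_of_isGluckTwist`,
Gluck 1962 §17, hypothesis `h17`) and the tree's proved `π₁(S⁴) = 1`
(`Literature.Topology.FourManifolds.simplyConnectedSpace_sphere_four_holds`).
[cite: KasprowskiPowellRay2023, Lemma 3.1] [cite: RenWillis2024, §6.10] [cite: GluckTAMS1962, §17] -/
theorem IsCP2Cancellative.apply_eq_of_isGluckTwist {α : Type*}
    {I : ∀ (M : Type) [TopologicalSpace M] [ChartedSpace (𝔼 4) M], α} (hI : IsCP2Cancellative I)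
    (hdis : gluckTwist_connectedSum_complexProjectivePlane)
    (hS : Literature.Topology.FourManifolds.isConnectedSum_sphere_self.{0} (n := 4)) (hex : Literature.Topology.FourManifolds.exists_isConnectedSum.{0} (n := 4))
    (h17 : ∀ K₂ : Literature.Topology.FourManifolds.TwoKnot, Literature.Topology.FourManifolds.nonempty_homotopyEquiv_sphere_of_isGluckTwist.{0} (K := K₂))
    (K : Literature.Topology.FourManifolds.TwoKnot) (X : Type) [TopologicalSpace X] [T2Space X] [SecondCountableTopology X]
    [ChartedSpace (𝔼 4) X] [IsManifold (𝓡 4) ∞ X] [CompactSpace X]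
    (hX : Literature.Topology.FourManifolds.IsGluckTwist (𝓡 4) X K) : I X = I (𝕊 4) := by
  haveI : Nonempty X := hX.nonempty
  haveI : SimplyConnectedSpace (𝕊 4) := Literature.Topology.FourManifolds.simplyConnectedSpace_sphere_four_holds
  obtain ⟨f⟩ := h17 K hX
  haveI : SimplyConnectedSpace X := f.simplyConnectedSpace
  obtain ⟨P, _, _, _, _, _, _, hP⟩ := hex X Literature.Topology.FourManifolds.ComplexProjectivePlane
  obtain ⟨e⟩ := hdis K X hX P hP
  exact hI X (𝕊 4) P Literature.Topology.FourManifolds.ComplexProjectivePlane hP (hS Literature.Topology.FourManifolds.ComplexProjectivePlane).symm ⟨e⟩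

/-- **`GluckTwistCP2Barrier` holds**, GIVEN the dissolution fact, the two tree facts on connected
sums, and the tree fact that Gluck twists are homotopy 4-spheres (D-0014: named facts enter as
hypotheses).
[cite: KasprowskiPowellRay2023, Lemma 3.1] [cite: ManolescuMarengonSarkarWillis2023, §9.3] -/
theorem gluckTwistCP2Barrier_of_dissolve (hdis : gluckTwist_connectedSum_complexProjectivePlane)
    (hS : Literature.Topology.FourManifolds.isConnectedSum_sphere_self.{0} (n := 4)) (hex : Literature.Topology.FourManifolds.exists_isConnectedSum.{0} (n := 4))
    (h17 : ∀ K₂ : Literature.Topology.FourManifolds.TwoKnot, Literature.Topology.FourManifolds.nonempty_homotopyEquiv_sphere_of_isGluckTwist.{0} (K := K₂)) :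
    GluckTwistCP2Barrier.{u} :=
  fun _ _ hI K X _ _ _ _ _ _ hX => hI.apply_eq_of_isGluckTwist hdis hS hex h17 K X hX

/-! ### The knot-level instance: the FGMW strategy with Rasmussen's `s` -/

/-- **MMSW 2023, Cor. 1.13, knot case** (named fact). If `X` is a (Hausdorff, second countable)
smooth 4-manifold which is a Gluck twist of `S⁴` along a 2-knot `K₂`, and a knot `K ⊂ S³` bounds
a smooth properly embedded disc in `X ∖ e(B̊⁴)` for a smooth ball `e` (`Literature.Knot.IsSliceDiscIn K X
e f`), then `s(K) = 0` (`Literature.Knot.HasRasmussenInvariant K s → s = 0`). Printed for links: "Let `X`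
be a homotopy 4-sphere obtained by a Gluck twist on a 2-knot in `S⁴`. If a link `L ⊂ S³` is
strongly slice in `X`, then `s(L) = 1 − |L|`"; the case `|L| = 1` is stated here. The tree's
`IsSliceDiscIn` allows ball embeddings `e` of either orientation; the printed proof (via
`X # ℂℙ² ≅ ℂℙ²`, `X # ℂℙ²bar ≅ ℂℙ²bar` and the bounds `s(L) ≤ 1 - |L|`, `s(L̄) ≤ 1 - |L|`) is
symmetric under this choice. [cite: ManolescuMarengonSarkarWillis2023, Cor. 1.13 (= Cor. 6.15)] -/
def rasmussen_eq_zero_of_isSliceDiscIn_gluckTwist : Prop :=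
  ∀ (K₂ : Literature.Topology.FourManifolds.TwoKnot) (X : Type) [TopologicalSpace X] [T2Space X] [SecondCountableTopology X]
    [ChartedSpace (𝔼 4) X] [IsManifold (𝓡 4) ∞ X] (_hX : Literature.Topology.FourManifolds.IsGluckTwist (𝓡 4) X K₂)
    (K : Literature.Topology.FourManifolds.Knot) (e : 𝔼 4 → X) (f : 𝔼 2 → X) (_hK : K.IsSliceDiscIn X e f)
    (s : ℤ) (_hs : K.HasRasmussenInvariant s), s = 0

/-- OPEN CONJECTURE — a registered open statement, [status: open]: posed (as a programme for
disproving `SmoothPoincare4`, proposed rather than asserted) in Freedman–Gompf–Morrison–Walker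
2010, §1, restated in Manolescu–Marengon–Sarkar–Willis 2023, §1 p. 5: "Find a homotopy 4-sphere `X` and a
knot `K ⊂ S³` that is slice in `X` ..., and prove that is not slice in `S⁴` by showing that
`s(K) ≠ 0`". Neither proved nor refuted in print: its negation is exactly MMSW's open
Question 9.11 for knots (`MMSW2023Question911Knot`, `not_fgmwRasmussenStrategy_iff_question`; "It
remains an open question whether the strategy can work for other homotopy 4-spheres", §9.3), only
the Gluck-twist case being refuted (Cor. 1.13, `not_fgmwRasmussenStrategyGluck`). NOT a named fact
awaiting discharge — a proof would exhibit an exotic 4-sphere (`FGMWRasmussenStrategy.exists_exotic`).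

**The FGMW strategy with Rasmussen's invariant succeeds** (as a Prop): some knot `K ⊂ S³` is slice
in a homotopy 4-ball (`Literature.Topology.FourManifolds.Knot.IsHomotopyBallSlice`: bounds a
smooth proper disc in `Σ ∖ B̊⁴` for a closed smooth `Σ ≃ₕ S⁴`) and has `s(K) ≠ 0`. The name is kept
(in-file API below; route docstrings cite it). [cite: FreedmanGompfMorrisonWalker2010, §1 pp. 3-4]
[cite: ManolescuMarengonSarkarWillis2023, §1 p. 5 and Question 9.11] -/
@[conjecture] def FGMWRasmussenStrategy : Prop :=
  ∃ K : Literature.Topology.FourManifolds.Knot, K.IsHomotopyBallSlice ∧ ∃ s : ℤ, K.HasRasmussenInvariant s ∧ s ≠ 0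

/-- OPEN CONJECTURE — posed, as a question, in Manolescu–Marengon–Sarkar–Willis 2023, §9.3,
Question 9.11 [cite: ManolescuMarengonSarkarWillis2023, Question 9.11]; [status: open]. A registered
OPEN STATEMENT, not a named fact awaiting discharge: neither a proof nor a disproof is in print
("It remains an open question whether the strategy can work for other homotopy 4-spheres", §9.3).
Printed: "Let `X` be a homotopy 4-sphere. If a link `L ⊂ S³` is strongly slice in `X`, do we have
`s(L) = 1 − |L|`?"; the knot case `|L| = 1` is stated here: every knot slice in a homotopy 4-ball
(`Literature.Topology.FourManifolds.Knot.IsHomotopyBallSlice`) has `s = 0`. The Gluck-twist case is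
Cor. 1.13 (`rasmussen_eq_zero_of_isSliceDiscIn_gluckTwist`); Kronheimer–Mrowka 2013, Cor. 1.1 had
asserted the general statement via `s = s♯`, an identification withdrawn in the authors'
corrigendum [cite: KronheimerMrowka2013, Cor. 1.1] [cite: KronheimerMrowka2019Corrigendum, abstract];
a negative answer would yield an exotic 4-sphere (`not_fgmwRasmussenStrategy_iff_question` with
`FGMWRasmussenStrategy.exists_exotic`), while `SmoothPoincare4` would imply a positive one (a
homotopy-ball slice disc would be a slice disc in `B⁴`, where `s = 0` [cite: Rasmussen2010, Thm. 1]).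
The name is kept (users in this file and in `GluckTwistsDissolveProofs.lean`). -/
@[conjecture] def MMSW2023Question911Knot : Prop :=
  ∀ (K : Literature.Topology.FourManifolds.Knot), K.IsHomotopyBallSlice → ∀ s : ℤ, K.HasRasmussenInvariant s → s = 0

/-- **What the strategy would deliver.** GIVEN Rasmussen's theorem that smoothly slice knots have
`s = 0` (tree fact `Literature.Topology.FourManifolds.eq_zero_of_isSmoothlySlice`, Rasmussen 2010 Thm. 1) and the FGMW
lemma (tree fact `Literature.Topology.FourManifolds.Knot.exists_exotic_of_isHomotopyBallSlice_not_isSmoothlySlice`: a knot slice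
in a homotopy ball but not in `B⁴` yields an exotic 4-sphere), a successful `FGMWRasmussenStrategy`
produces a closed smooth 4-manifold homotopy equivalent but not diffeomorphic to `S⁴`.
[cite: FreedmanGompfMorrisonWalker2010, §1] [cite: Rasmussen2010, Thm. 1] -/
theorem FGMWRasmussenStrategy.exists_exotic (h : FGMWRasmussenStrategy)
    (hs0 : Literature.Topology.FourManifolds.eq_zero_of_isSmoothlySlice)
    (hF : Literature.Topology.FourManifolds.Knot.exists_exotic_of_isHomotopyBallSlice_not_isSmoothlySlice) :
    ∃ (M : Type) (_ : TopologicalSpace M) (_ : T2Space M) (_ : SecondCountableTopology M)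
      (_ : ChartedSpace (𝔼 4) M) (_ : IsManifold (𝓡 4) ∞ M) (_ : CompactSpace M),
      Nonempty (M ≃ₕ 𝕊 4) ∧ IsEmpty (M ≃ₘ⟮𝓡 4, 𝓡 4⟯ 𝕊 4) := by
  obtain ⟨K, hK, s, hs, hs0'⟩ := h
  exact hF ⟨K, hK, fun hsl => hs0' (hs0 hs hsl)⟩

/-- **The barrier at knot level (MMSW 2023, Cor. 1.13): the FGMW `s`-strategy cannot succeed on a
Gluck twist**, GIVEN the named fact `rasmussen_eq_zero_of_isSliceDiscIn_gluckTwist` (Cor. 1.13 for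
knots): there is NO 2-knot `K₂`, closed smooth (Hausdorff, second countable, compact) 4-manifold `X`
which is a Gluck twist of `S⁴` along `K₂`, knot `K ⊂ S³` bounding a smooth proper disc `f` in
`X ∖ e(B̊⁴)` for a smooth ball `e` (`Knot.IsSliceDiscIn K X e f`), and integer `s` with
`Knot.HasRasmussenInvariant K s` and `s ≠ 0` ("this strategy cannot work for ... those obtained by
Gluck twists", p. 5). The negated existential is the former closed Prop
`FGMWRasmussenStrategyGluck` of this file (deleted 2026-08-15: refuted, not a fact), spelled out.
[cite: ManolescuMarengonSarkarWillis2023, Cor. 1.13 and p. 5] -/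
theorem not_fgmwRasmussenStrategyGluck (h : rasmussen_eq_zero_of_isSliceDiscIn_gluckTwist) :
    ¬ ∃ (K₂ : Literature.Topology.FourManifolds.TwoKnot) (X : Type) (_ : TopologicalSpace X)
        (_ : T2Space X) (_ : SecondCountableTopology X) (_ : ChartedSpace (𝔼 4) X)
        (_ : IsManifold (𝓡 4) ∞ X) (_ : CompactSpace X),
        Literature.Topology.FourManifolds.IsGluckTwist (𝓡 4) X K₂ ∧
          ∃ (K : Literature.Topology.FourManifolds.Knot) (e : 𝔼 4 → X) (f : 𝔼 2 → X),
            K.IsSliceDiscIn X e f ∧ ∃ s : ℤ, K.HasRasmussenInvariant s ∧ s ≠ 0 := by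
  rintro ⟨K₂, X, _, _, _, _, _, _, hX, K, e, f, hK, s, hs, hs0⟩
  exact hs0 (h K₂ X hX K e f hK s hs)

/-- **Where the barrier stops.** The general FGMW `s`-strategy fails if and only if MMSW's open
Question 9.11 (knot case) has a positive answer — a logical triviality recorded to make the scope
explicit: beyond Gluck twists nothing is printed. [cite: ManolescuMarengonSarkarWillis2023, §9.3] -/
theorem not_fgmwRasmussenStrategy_iff_question :
    ¬ FGMWRasmussenStrategy ↔ MMSW2023Question911Knot := by
  constructor
  · intro h K hK s hs
    by_contra hs0
    exact h ⟨K, hK, s, hs, hs0⟩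
  · rintro h ⟨K, hK, s, hs, hs0⟩
    exact hs0 (h K hK s hs)

/-! ### Beyond Gluck twists: MMSW's dissolution lemma for arbitrary homotopy 4-spheres (§9.3) -/

section BeyondGluck

/-- Local notation: the standard `4`-sphere `𝕊⁴ ⊂ ℝ⁵`. -/
local notation "𝕊⁴" => (Metric.sphere (0 : EuclideanSpace ℝ (Fin 5)) 1)

/-- **`X` dissolves in `ℂℙ²`**: every closed smooth (Hausdorff, second countable, compact) connected sum of
`X` with `ℂℙ²`, in the tree's relational and orientation-free sense `IsConnectedSum`, is diffeomorphic to
`ℂℙ²`. Since `P` ranges over both `X # ℂℙ²` and `X # ℂℙ²bar` (as unoriented manifolds; `ℂℙ²bar ≅ ℂℙ²`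
unoriented), for a homotopy 4-sphere `X` this is exactly the conjunction of the two printed dissolutions
"`X # ℂℙ² ≅ ℂℙ²` and `X # ℂℙ²bar ≅ ℂℙ²bar`" (the hypothesis of MMSW's remark, case `r = 1`); the fact
`gluckTwist_connectedSum_complexProjectivePlane` says that every Gluck twist of `S⁴` dissolves in this sense
(`dissolvesInCP2_of_isGluckTwist`). A definition (predicate in `X`), not a closed named fact.
[cite: ManolescuMarengonSarkarWillis2023, §9.3] -/
def DissolvesInCP2 (X : Type) [TopologicalSpace X] [T2Space X] [ChartedSpace (𝔼 4) X] : Prop :=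
  ∀ (P : Type) [TopologicalSpace P] [T2Space P] [SecondCountableTopology P] [ChartedSpace (𝔼 4) P]
    [IsManifold (𝓡 4) ∞ P] [CompactSpace P],
    Literature.Topology.FourManifolds.IsConnectedSum (𝓡 4) (𝓡 4) (𝓡 4) X
        Literature.Topology.FourManifolds.ComplexProjectivePlane P →
      Nonempty (P ≃ₘ⟮𝓡 4, 𝓡 4⟯ Literature.Topology.FourManifolds.ComplexProjectivePlane)

/-- **MMSW 2023, §9.3 (named fact; case `r = 1`, knots): the `s`-invariant is blind on every homotopy
4-sphere that dissolves in `ℂℙ²` and `ℂℙ²bar`.** If `X` is a closed smooth (Hausdorff, second countable,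
compact) 4-manifold homotopy equivalent to `S⁴` which `DissolvesInCP2`, and a knot `K ⊂ S³` bounds a smooth
proper disc in `X ∖ e(B̊⁴)` (`Knot.IsSliceDiscIn K X e f`), then `s(K) = 0`
(`Knot.HasRasmussenInvariant K s → s = 0`). Printed (§9.3, the sentence after Question 9.11): "When `X` was
obtained by a Gluck twist from `S⁴`, the key facts we used to answer this question in the affirmative were
that `X # ℂℙ² ≅ ℂℙ²` and `X # ℂℙ²bar ≅ ℂℙ²bar`. The same result would hold for any homotopy 4-sphere `X`
satisfying `X # (#ʳℂℙ²) = #ʳℂℙ²` and `X # (#ʳℂℙ²bar) = #ʳℂℙ²bar` for some `r`." — with the proof of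
Cor. 6.15: `L` strongly H-slice in `X` is strongly H-slice in `X # ℂℙ²bar ≅ ℂℙ²bar`, and `L̄` likewise, so
Cor. 6.13 (`L` strongly H-slice in `#ᵗℂℙ²bar` ⇒ `s(L) ≤ 1 - |L|`) gives `s(L) ≤ 1 - |L|` and
`s(L̄) ≤ 1 - |L|`, whence equality by `s(L) + s(L̄) ≥ 2 - 2|L|` (Thm. 6.14). Only `r = 1`, `|L| = 1` is
stated (the tree has no iterated connected sum and no link `s`); as for Cor. 1.13, the tree's
`IsSliceDiscIn` allows ball embeddings of either orientation, which the symmetric printed proof covers.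
[cite: ManolescuMarengonSarkarWillis2023, §9.3 (remark after Question 9.11) and proof of Cor. 6.15] -/
def mmsw2023_sZero_of_dissolvesInCP2 : Prop :=
  ∀ (X : Type) [TopologicalSpace X] [T2Space X] [SecondCountableTopology X] [ChartedSpace (𝔼 4) X]
    [IsManifold (𝓡 4) ∞ X] [CompactSpace X] (_hX : Nonempty (X ≃ₕ 𝕊⁴)) (_hd : DissolvesInCP2 X)
    (K : Literature.Topology.FourManifolds.Knot) (e : 𝔼 4 → X) (f : 𝔼 2 → X)
    (_hK : K.IsSliceDiscIn X e f) (s : ℤ) (_hs : K.HasRasmussenInvariant s), s = 0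

/-- Every Gluck twist of `S⁴` dissolves in `ℂℙ²` — a rephrasing of the dissolution fact
`gluckTwist_connectedSum_complexProjectivePlane`. [cite: KasprowskiPowellRay2023, Lemma 3.1]
[cite: ManolescuMarengonSarkarWillis2023, proof of Cor. 6.15] -/
theorem dissolvesInCP2_of_isGluckTwist (hdis : gluckTwist_connectedSum_complexProjectivePlane)
    (K₂ : Literature.Topology.FourManifolds.TwoKnot) (X : Type) [TopologicalSpace X] [T2Space X]
    [SecondCountableTopology X] [ChartedSpace (𝔼 4) X] [IsManifold (𝓡 4) ∞ X]
    (hX : Literature.Topology.FourManifolds.IsGluckTwist (𝓡 4) X K₂) : DissolvesInCP2 X :=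
  fun P _ _ _ _ _ _ hP ↦ hdis K₂ X hX P hP

/-- **The §9.3 fact contains the knot case of Cor. 1.13** for closed Gluck twists given with a homotopy
equivalence to `S⁴` (in print automatic: a Gluck twist of `S⁴` is a closed homotopy 4-sphere, the tree's
fact `nonempty_homotopyEquiv_sphere_of_isGluckTwist`), GIVEN the dissolution fact.
[cite: ManolescuMarengonSarkarWillis2023, Cor. 1.13 and §9.3] -/
theorem sZero_of_isSliceDiscIn_gluckTwist_of_mmsw2023 (hM : mmsw2023_sZero_of_dissolvesInCP2)
    (hdis : gluckTwist_connectedSum_complexProjectivePlane)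
    (K₂ : Literature.Topology.FourManifolds.TwoKnot) (X : Type) [TopologicalSpace X] [T2Space X]
    [SecondCountableTopology X] [ChartedSpace (𝔼 4) X] [IsManifold (𝓡 4) ∞ X] [CompactSpace X]
    (hX : Literature.Topology.FourManifolds.IsGluckTwist (𝓡 4) X K₂) (hXh : Nonempty (X ≃ₕ 𝕊⁴))
    (K : Literature.Topology.FourManifolds.Knot) (e : 𝔼 4 → X) (f : 𝔼 2 → X)
    (hK : K.IsSliceDiscIn X e f) (s : ℤ) (hs : K.HasRasmussenInvariant s) : s = 0 :=
  hM X hXh (dissolvesInCP2_of_isGluckTwist hdis K₂ X hX) K e f hK s hs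

/-- **`ℂℙ²`-rigidity on homotopy-sphere sums answers Question 9.11 (knots) positively**, GIVEN the §9.3
fact. The hypothesis `hC` — every closed smooth homotopy 4-sphere `DissolvesInCP2`, i.e. every closed
smooth `Σ # ℂℙ²` (either orientation) with `Σ ≃ₕ S⁴` is diffeomorphic to `ℂℙ²` — is an OPEN statement
(it follows from `SmoothPoincare4`, and from uniqueness of the smooth structure on `ℂℙ²` with Freedman;
no exotic `ℂℙ²` is known: Manolescu's 2026 survey, arXiv:2601.05425, Question 3.2); it is spelled out
here, to be filed Summits-side as an obligation by a planner who wants it as a kill switch.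
[cite: ManolescuMarengonSarkarWillis2023, §9.3] -/
theorem mmsw2023Question911Knot_of_cp2Rigid (hM : mmsw2023_sZero_of_dissolvesInCP2)
    (hC : ∀ (X : Type) [TopologicalSpace X] [T2Space X] [SecondCountableTopology X]
      [ChartedSpace (𝔼 4) X] [IsManifold (𝓡 4) ∞ X] [CompactSpace X],
      Nonempty (X ≃ₕ 𝕊⁴) → DissolvesInCP2 X) :
    MMSW2023Question911Knot := by
  intro K hK s hs
  obtain ⟨X, _, _, _, _, _, _, hX, e, f, hKX⟩ := hK
  exact hM X hX (hC X hX) K e f hKX s hs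

/-- **The FGMW `s`-strategy is blocked by `ℂℙ²`-rigidity on homotopy-sphere sums** (GIVEN the §9.3 fact):
the barrier of this file, extended from Gluck twists to every homotopy 4-sphere that dissolves.
[cite: ManolescuMarengonSarkarWillis2023, §9.3] -/
theorem not_fgmwRasmussenStrategy_of_cp2Rigid (hM : mmsw2023_sZero_of_dissolvesInCP2)
    (hC : ∀ (X : Type) [TopologicalSpace X] [T2Space X] [SecondCountableTopology X]
      [ChartedSpace (𝔼 4) X] [IsManifold (𝓡 4) ∞ X] [CompactSpace X],
      Nonempty (X ≃ₕ 𝕊⁴) → DissolvesInCP2 X) :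
    ¬ FGMWRasmussenStrategy :=
  not_fgmwRasmussenStrategy_iff_question.2 (mmsw2023Question911Knot_of_cp2Rigid hM hC)

/-- **The price of an `s`-witness: an exotic `ℂℙ²`-sum** (GIVEN the §9.3 fact). If some knot slice in a
homotopy 4-ball has `s ≠ 0`, then its closed smooth homotopy 4-sphere `X` does not dissolve: there is a
closed smooth connected sum `P` of `X` with `ℂℙ²` admitting NO diffeomorphism to `ℂℙ²` — by Freedman's
classification `P` (closed, smooth, simply connected, intersection form `⟨±1⟩`) is homeomorphic to `ℂℙ²`,
i.e. the strategy can only succeed by also exhibiting an exotic `ℂℙ²` (up to orientation): the case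
`n = 1` of "is there an exotic `#n ℂℙ²`?" (Manolescu 2026 survey, arXiv:2601.05425, Question 3.2).
[cite: ManolescuMarengonSarkarWillis2023, §9.3]
[cite: FreedmanGompfMorrisonWalker2010, §1] -/
theorem exoticCP2Sum_of_fgmwRasmussenStrategy (hM : mmsw2023_sZero_of_dissolvesInCP2)
    (h : FGMWRasmussenStrategy) :
    ∃ (X : Type) (_ : TopologicalSpace X) (_ : T2Space X) (_ : SecondCountableTopology X)
      (_ : ChartedSpace (𝔼 4) X) (_ : IsManifold (𝓡 4) ∞ X) (_ : CompactSpace X),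
      Nonempty (X ≃ₕ 𝕊⁴) ∧
      (∃ (K : Literature.Topology.FourManifolds.Knot) (e : 𝔼 4 → X) (f : 𝔼 2 → X) (s : ℤ),
        K.IsSliceDiscIn X e f ∧ K.HasRasmussenInvariant s ∧ s ≠ 0) ∧
      ∃ (P : Type) (_ : TopologicalSpace P) (_ : T2Space P) (_ : SecondCountableTopology P)
        (_ : ChartedSpace (𝔼 4) P) (_ : IsManifold (𝓡 4) ∞ P) (_ : CompactSpace P),
        Literature.Topology.FourManifolds.IsConnectedSum (𝓡 4) (𝓡 4) (𝓡 4) X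
            Literature.Topology.FourManifolds.ComplexProjectivePlane P ∧
          IsEmpty (P ≃ₘ⟮𝓡 4, 𝓡 4⟯ Literature.Topology.FourManifolds.ComplexProjectivePlane) := by
  obtain ⟨K, ⟨X, _, _, _, _, _, _, hX, e, f, hKX⟩, s, hs, hs0⟩ := h
  refine ⟨X, ‹_›, ‹_›, ‹_›, ‹_›, ‹_›, ‹_›, hX, ⟨K, e, f, s, hKX, hs, hs0⟩, ?_⟩
  by_contra hne
  refine hs0 (hM X hX ?_ K e f hKX s hs)
  intro P _ _ _ _ _ _ hP
  by_contra hP'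
  exact hne ⟨P, ‹_›, ‹_›, ‹_›, ‹_›, ‹_›, ‹_›, hP, not_nonempty_iff.1 hP'⟩

end BeyondGluck

end Literature.Barriers.SmoothPoincare4

end
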